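import Summits.AtomisticToContinuum.FouriersLaw.Theses.DiluteCellGaussianiser

/-!
# Birth skeleton (BC3) for the crux `DiluteCellGaussianiser.DiluteFourierLaw`
(crux item stmt-AtomisticToContinuum-12893, rank 5 of route `route-AtomisticToContinuum-DiluteCellGaussianiser`;
published as `Cruxes/DiluteFourierLaw/Lines/birth.lean`)

Crux (FIXED, concluded BY NAME below):
`Summit.AtomisticToContinuum.FouriersLaw.Theses.DiluteCellGaussianiser.DiluteFourierLaw` — for all
`ω₂, lam, β, γ > 0` and every `T > 0` there is `d₀` such that for every spacing `d ≥ d₀` the `d`-dilute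
conjunct chain `C_d = diluteChain ω₂ lam β γ d` satisfies `SiteChain.FouriersLawAt T`: some `k ∈ (0, ∞)`
such that along EVERY family `μ N T_L T_R` of weak steady states the finite-size response limits
`D_N = lim_{δ→0, δ≠0} totalCurrent(μ_{N,T+δ/2,T-δ/2})/δ` exist and `D_N → k`.

## The line: finite-`N` response calculus + Ohmic staircase (Matthiessen additivity of dilute cells)

`totalCurrent = (N-1)·J`, so `R_N := (N-1)/D_N = lim δT/J` is the bath-to-bath thermal RESISTANCE of
the `N`-site chain at first order. The refuters' read-back of the crux (rattack-12893, rreview-0815,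
g43-37, g44-8/50/57, grounder g25-39) isolated its HIDDEN finite-`N` content — current-uniqueness and
`δ`-differentiability of the weak steady states of `C_d` at every `N` ("file DiluteNessUnique and the
fixed-N response step") — from its TRANSPORT content (`N`-uniform). This skeleton types exactly that cut,
with the transport content in the form the route's engine is meant to deliver (route header NUMBERS:
"expected staircase `R_(Md) = M·r_d + c_d` with corrections summable in `M`"; support
PerCellResistanceLimit; CHEAPEST FALSIFIER (a): "is `R_N` affine in `M`"):

* S1 `stub_diluteNessUnique` (size L): weak steady states of `C_d` are unique at every
  `(N, T_L, T_R)` — Cuneo–Eckmann–Hairer–Rey-Bellet 2018 Thm 2.13(1) (C1 path with end baths, C2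
  `V_i'' ≥ 1`, CA) for the invariant measure plus the weak-Fokker–Planck ⇒ invariant identification,
  the `d`-dilute analogue of the LANDED `NessUnique` (`nessUnique_proof`, `d = 1` by `diluteChain_one`).
* S2 `stub_diluteFiniteResponseOfUnique` (size L–XL): under S1, along every steady-state family the
  response limit `D_N` exists at every `N` — the `d`-dilute analogue of the LANDED
  `FiniteResponseOfUnique` (`finiteResponseOfUnique_holds`; Hairer–Majda parameter-differentiability),
  here in the mixed-degree (harmonic bond before / quartic bond after each cell) Hairer–Mattingly regime.
* S3 `stub_positiveResponse` (size M–L): under S1, every response coefficient of `C_d` at `N ≥ 2` is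
  `> 0` (heat flows hot → cold at first order: the finite-volume Green–Kubo variance is non-degenerate)
  — the analogue of the LANDED `FeketeSeriesLaw.PositiveConductance` (`d = 1`).
* S4 `stub_ohmicStaircase` (size XL / open; the HARDEST stub, carrying all the anharmonicity): for
  `d ≥ d₀`, under S1, there are a per-cell resistance `r = r_d(T) > 0`, a constant `C` and `N₀` such
  that every POSITIVE response coefficient `D` of `C_d` at `N ≥ N₀` has `|(N-1)/D - r·N/d| ≤ C`:
  the resistance of the dilute chain is the number of cells `≈ N/d` times `r`, up to a bounded
  contact/residue term — resistances of far-apart deterministic anharmonic cells ADD (the output of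
  the route's engine CellChainOhm ∘ Gaussianiser, or of the sibling renewal engine). FALSE at the
  harmonic corner `lam = β = 0` (Rieder–Lebowitz–Lieb: `R_N = O(1)`,
  `Literature.Barriers.AtomisticToContinuum.HarmonicChainBallisticFlux`), where S1–S3 hold — so S1–S3
  cannot imply the crux and all anharmonic input sits in S4, exactly as the refuters' mutation check
  (`lam = β = 0 ⇒` crux false at every `d`) demands.
* `of_parts : <S1-sig> → <S2-sig> → <S3-sig> → <S4-sig> → <crux body>` is PROVED (real analysis:
  `k := d/r`; along a family, S2 gives `D_N`, each `D_N` is a response coefficient, S3/S4 give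
  `D_N > 0` and `(N-1)/D_N = r N/d + O(1)`, hence `D_N = ((N-1)/N) / (((N-1)/D_N)/N) → 1/(r/d) = d/r`),
  and `DiluteFourierLaw_of : DiluteFourierLaw := of_parts stub… ` concludes the crux BY NAME (the
  hypotheses form is kept on `of_parts`, whose conclusion is the crux body written out, because the
  skeleton audit admits only named obligations as binders of the theorem concluding the crux).

Vacuity (refuter evidence `fouriersLawAt_of_no_steadyState`, honoured): neither the crux nor S2–S4
assert EXISTENCE of steady states of `C_d` (open for `d ≥ 2`, `N ≥ 3`: mixed interaction degrees,
CEHR 2018 Remark 2.11 / Hairer–Mattingly 2009); all are vacuous at a size without steady states, and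
non-vacuity stays with the route's support DiluteNessExists (stmt-AtomisticToContinuum-12897), as
designed in `SiteDependentOscillatorChain.lean` ("FouriersLawAt carries NO existence clause").

Disproof used: none — `ledger crux ls stmt-AtomisticToContinuum-12893` showed no workfiles (no
`Disproof.lean`, no `Negative/` lemma, no dead line) at registration (2026-08-17).

BC3 probes (planner folder `bc/`): for each stub `S`, `S → DiluteFourierLaw` and `S → FouriersLaw` by
`first | exact? | simpa | aesop` FAIL (NOTES.md `birth-certificate:` records rc and goals).
-/

set_option autoImplicit false

noncomputable section

namespace Summit.AtomisticToContinuum.FouriersLaw.Cruxes.DiluteFourierLaw.Birth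

open MeasureTheory Filter Topology
open Literature.MathematicalPhysics.KineticTheory.HeatConduction
open Summit.AtomisticToContinuum.FouriersLaw.Theses.DiluteCellGaussianiser (DiluteFourierLaw)

set_option linter.unusedVariables false

/-! ## S1 — uniqueness of the weak steady states of the dilute chain -/

/-- **S1 `stub_diluteNessUnique`** (DILUTE NESS UNIQUENESS; size L). For `ω₂, lam, β, γ > 0`, every
spacing `d`, every `N` and all `T_L, T_R > 0`, any two weak steady states
(`SiteChain.IsSteadyState`: probability, `∫ L f dμ = 0` for `f ∈ C_c^∞`, integrable bond currents) of
`diluteChain ω₂ lam β γ d` coincide. Why plausibly true: uniqueness of the INVARIANT measure is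
Cuneo–Eckmann–Hairer–Rey-Bellet 2018 Thm 2.13 bullet 1 (conditions C1: path graph with baths at both
ends; C2: `V_i'' = 1 + 3[d ∣ i] β r² ≠ 0`; CA), which — unlike existence, bullet 2 — does NOT need a
common interaction degree; the remaining `weak Fokker–Planck solution ⇒ invariant` identification is the
pattern PROVED in tree for `d = 1` (`nessUnique_proof`, item NessUnique stmt-0741; `diluteChain_one`).
Why it might fail: only through the identification step for the hypoelliptic generator with cubic
drifts at the cells (well-posedness of the `C_c^∞` martingale problem / non-explosion), as for 0741.
Leans on: `diluteChain_generator`, `diluteChain_isSteadyState_iff`, `NessUnique_holds` (d = 1),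
`SiteChain.isSteadyState_zero`. Sources: CuneoEckmannHairerReyBellet2018 Thm 2.13(1), Carmona2007,
ReyBelletThomas2002, EckmannPilletReyBellet1999a. -/
theorem stub_diluteNessUnique :
    ∀ ω₂ lam β γ : ℝ, 0 < ω₂ → 0 < lam → 0 < β → 0 < γ → ∀ (d N : ℕ) (T_L T_R : ℝ),
    0 < T_L → 0 < T_R → ∀ μ ν : Measure (PhaseSpace N),
      (diluteChain ω₂ lam β γ d).IsSteadyState N T_L T_R μ →
      (diluteChain ω₂ lam β γ d).IsSteadyState N T_L T_R ν → μ = ν := by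
  sorry

/-! ## S2 — finite-`N` linear response of the dilute chain exists (given uniqueness) -/

/-- **S2 `stub_diluteFiniteResponseOfUnique`** (FIXED-`N` RESPONSE STEP; size L–XL). For
`ω₂, lam, β, γ > 0` and every spacing `d`: IF the weak steady states of `C_d = diluteChain ω₂ lam β γ d`
are unique at every `(N, T_L, T_R)` (S1), then along every family `μ N T_L T_R` of weak steady states,
for every `T > 0` and every `N` the first-order response limit
`D_N = lim_{δ→0, δ≠0} totalCurrent(μ N (T+δ/2) (T-δ/2))/δ` EXISTS. The verbatim `d`-dilute analogue of
the LANDED item FiniteResponseOfUnique (stmt-0717, `finiteResponseOfUnique_holds`, `d = 1`). Why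
plausibly true: differentiability in the bath temperatures of NESS expectations of the polynomial bond
currents (Rey-Bellet 2003 Rem. 4.4 finite-volume Green–Kubo; Hairer–Majda 2009 Thm 2.3 framework);
`N = 0, 1`: `totalCurrent ≡ 0`, `D = 0`. Why it might fail: for `d ≥ 2` each cell has a HARMONIC bond
on one side and a QUARTIC bond on the other (interaction degrees 2 and 4 mixed): this is the
Hairer–Mattingly regime where no spectral gap is known (slow energy release from high-energy cell
states), so the `d = 1` route to differentiability (weighted spectral gap, CEHR (2.5) / Carmona Thm
1.1(iv)) is not available as is; existence of the steady states themselves is open there (the item is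
then vacuous, not false). Leans on: `diluteChain_generator`, `diluteChain_totalCurrent`,
`finiteResponseOfUnique_holds` (d = 1). Sources: ReyBellet2003, HairerMajda2009,
CuneoEckmannHairerReyBellet2018, HairerMattingly2009. -/
theorem stub_diluteFiniteResponseOfUnique :
    ∀ ω₂ lam β γ : ℝ, 0 < ω₂ → 0 < lam → 0 < β → 0 < γ → ∀ d : ℕ,
    (∀ (N : ℕ) (T_L T_R : ℝ), 0 < T_L → 0 < T_R → ∀ μ ν : Measure (PhaseSpace N),
      (diluteChain ω₂ lam β γ d).IsSteadyState N T_L T_R μ →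
      (diluteChain ω₂ lam β γ d).IsSteadyState N T_L T_R ν → μ = ν) →
    ∀ μ : (N : ℕ) → ℝ → ℝ → Measure (PhaseSpace N),
    (∀ (N : ℕ) (T_L T_R : ℝ), 0 < T_L → 0 < T_R →
      (diluteChain ω₂ lam β γ d).IsSteadyState N T_L T_R (μ N T_L T_R)) →
    ∀ T : ℝ, 0 < T → ∀ N : ℕ, ∃ D : ℝ,
      Tendsto (fun δ : ℝ => (diluteChain ω₂ lam β γ d).totalCurrent (μ N (T + δ / 2) (T - δ / 2)) / δ)
        (𝓝[≠] 0) (𝓝 D) := by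
  sorry

/-! ## S3 — positivity of the finite-`N` response (heat flows from hot to cold at first order) -/

/-- **S3 `stub_positiveResponse`** (POSITIVE RESPONSE; size M–L). For `ω₂, lam, β, γ > 0`, `T > 0`,
every spacing `d`, under uniqueness of the weak steady states of `C_d` (S1): every finite-size response
coefficient `D` of `C_d` at `(N, T)` with `N ≥ 2` (`SiteChain.IsResponseCoeff`: the limit
`lim_{δ→0,δ≠0} totalCurrent(μ (T+δ/2) (T-δ/2))/δ` along some steady-state family at size `N`) is
STRICTLY POSITIVE. The `d`-dilute analogue of the LANDED crux FeketeSeriesLaw.PositiveConductance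
(stmt-11750, `d = 1`, `N ≥ 2`): `D_N` is a finite-volume Green–Kubo variance `lim Var(Q_t)/(2tT²)`,
non-degenerate because the time-integrated contact current is not an `L²`-coboundary
(Kundu–Dhar–Narayan 2009 open-chain Green–Kubo; Rey-Bellet 2003 Rem. 4.4; Eckmann–Pillet–Rey-Bellet
1999b). `N ≤ 1` is excluded (`totalCurrent ≡ 0`, `D = 0`, refuter rattack-12893). Why it might fail:
the Green–Kubo representation of `D` needs the same fixed-`N` regularity as S2 in the mixed-degree
regime; the sign itself is not in doubt. Leans on: `SiteChain.IsResponseCoeff`,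
`diluteChain_bondCurrent`, the `d = 1` proof
`BoundedResponseConverges.TwoScaleGluingLogRigidity.Stubs.positiveConductance_holds`. Sources: KunduDharNarayan2009,
ReyBellet2003, EckmannPilletReyBellet1999b, BonettoLebowitzReyBellet2000 §6. -/
theorem stub_positiveResponse :
    ∀ ω₂ lam β γ : ℝ, 0 < ω₂ → 0 < lam → 0 < β → 0 < γ → ∀ T : ℝ, 0 < T → ∀ d : ℕ,
    (∀ (N : ℕ) (T_L T_R : ℝ), 0 < T_L → 0 < T_R → ∀ μ ν : Measure (PhaseSpace N),
      (diluteChain ω₂ lam β γ d).IsSteadyState N T_L T_R μ →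
      (diluteChain ω₂ lam β γ d).IsSteadyState N T_L T_R ν → μ = ν) →
    ∀ N : ℕ, 2 ≤ N → ∀ D : ℝ, (diluteChain ω₂ lam β γ d).IsResponseCoeff N T D → 0 < D := by
  sorry

/-! ## S4 — the Ohmic staircase: resistances of dilute anharmonic cells add -/

/-- **S4 `stub_ohmicStaircase`** (MATTHIESSEN ADDITIVITY OF DILUTE CELLS = OHM'S LAW WITH A BOUNDED
CONTACT TERM; size XL / open — the HARDEST stub, the one carrying the anharmonicity). For
`ω₂, lam, β, γ > 0` and `T > 0` there is `d₀` such that for every spacing `d ≥ d₀`, under uniqueness of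
the weak steady states of `C_d = diluteChain ω₂ lam β γ d` (S1), there are a PER-CELL RESISTANCE
`r = r_d(T) > 0`, a constant `C` and a size `N₀` such that every positive response coefficient `D` of
`C_d` at `(N, T)` with `N ≥ N₀` satisfies `|(N-1)/D - r·N/d| ≤ C`. Reading: `(N-1)/D = lim δT/J` is
the bath-to-bath resistance `R_N`; the `N`-site chain carries `⌈N/d⌉` cells (sites `d ∣ i`) separated
by harmonic segments, each of which is ballistic (length-independent resistance, Rieder–Lebowitz–Lieb
/ Casher–Lebowitz), so in the INCOHERENT picture `R_N = ⌈N/d⌉·r_d + c_(N mod d) + o(1)` — an affine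
staircase in the number of cells with a bounded residue/contact term: exactly the route's NUMBERS
("expected staircase `R_(Md) = M·r_d + c_d` with corrections summable in `M`"), the content of its
support PerCellResistanceLimit (`|d/κ_d - r| < ε`: here `κ_d = d/r_d`) and what its engine
(FarFieldGaussianityR → SingleCellMixing → CellChainOhm: the `M`-cell NESS in linear response is an
`ε_d`-perturbation, uniformly in `M`, of the incoherent cell chain, whose resistances ADD by
Perron–Frobenius) or the sibling renewal/kinetic-window engine must output. Calibration: FALSE at
`lam = β = 0` for every `d` (harmonic host: `R_N = O(1)`, `HarmonicChainBallisticFlux`,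
`not_hasBoundedResponse`) — a proof must use `lam, β > 0`; `d₀(T) → ∞` as `T → 0` is allowed
(LowTemperatureWeakAnharmonicity, kinetic corner `κ ≍ (lam T)⁻²`). Why it might fail (the crux's own):
cells may not mix at a rate (defect breathers above `E* ~ c/lam`, Arrhenius-slow release); the
Gaussianisation errors `ε_d` must be summable UNIFORMLY in `M` — coherent inter-cell (Fabry–Pérot)
correlations surviving thermal averaging would make the corrections grow (a `log N` or `N^α` drift of
`R_N - rN/d` kills THIS stub while a weaker `o(N)` form, equivalent to the crux, could survive).
Leans on: `SiteChain.IsResponseCoeff`, `diluteChain_eq_cellChain`, `CellScattering` interface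
(CellTransferOperator.lean) for the engine; numerics: the route's cheapest falsifier (a) and refuter
rattack-12893's MD job j004121 (`R_N` vs `N`, `d ∈ {1,2,4,8}`; no summary attached at registration).
Sources: BonettoLebowitzReyBellet2000 §5.3/§10, CasherLebowitz1971, RiederLebowitzLieb1967,
Buttiker1986, BonettoLebowitzLukkarinen2004, Dhar2008 §3/§5, KomorowskiOlla2020, arXiv:1405.3868,
AokiLukkarinenSpohn2006. -/
theorem stub_ohmicStaircase :
    ∀ ω₂ lam β γ : ℝ, 0 < ω₂ → 0 < lam → 0 < β → 0 < γ → ∀ T : ℝ, 0 < T →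
    ∃ d₀ : ℕ, ∀ d : ℕ, d₀ ≤ d →
    (∀ (N : ℕ) (T_L T_R : ℝ), 0 < T_L → 0 < T_R → ∀ μ ν : Measure (PhaseSpace N),
      (diluteChain ω₂ lam β γ d).IsSteadyState N T_L T_R μ →
      (diluteChain ω₂ lam β γ d).IsSteadyState N T_L T_R ν → μ = ν) →
    ∃ r : ℝ, 0 < r ∧ ∃ (C : ℝ) (N₀ : ℕ), ∀ N : ℕ, N₀ ≤ N → ∀ D : ℝ,
      (diluteChain ω₂ lam β γ d).IsResponseCoeff N T D → 0 < D →
      |((N : ℝ) - 1) / D - r * (N : ℝ) / (d : ℝ)| ≤ C := by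
  sorry

/-! ## The composition (fully proved) -/

/-- A bounded perturbation of a linear staircase has the linear slope: if `|R N - r N / d| ≤ C`
eventually then `R N / N → r / d`. [folklore] -/
theorem tendsto_div_nat_of_abs_sub_linear_le {R : ℕ → ℝ} {r d C : ℝ} {N₀ : ℕ}
    (h : ∀ N : ℕ, N₀ ≤ N → |R N - r * (N : ℝ) / d| ≤ C) :
    Tendsto (fun N : ℕ => R N / (N : ℝ)) atTop (𝓝 (r / d)) := by
  rw [tendsto_iff_norm_sub_tendsto_zero]
  refine squeeze_zero_norm' ?_ (tendsto_const_div_atTop_nhds_zero_nat |C|)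
  filter_upwards [eventually_ge_atTop N₀, eventually_gt_atTop 0] with N hN hN0
  have hNpos : (0 : ℝ) < (N : ℝ) := by exact_mod_cast hN0
  have hkey : R N / (N : ℝ) - r / d = (R N - r * (N : ℝ) / d) / (N : ℝ) := by
    field_simp
  simp only [Real.norm_eq_abs, abs_abs]
  rw [hkey, abs_div, abs_of_pos hNpos]
  exact div_le_div_of_nonneg_right (le_trans (h N hN) (le_abs_self C)) hNpos.le

/-- `(N - 1)/N → 1` along the naturals. [folklore] -/
theorem tendsto_sub_one_div_nat : Tendsto (fun N : ℕ => ((N : ℝ) - 1) / (N : ℝ)) atTop (𝓝 1) := by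
  have h : Tendsto (fun N : ℕ => (1 : ℝ) - 1 / (N : ℝ)) atTop (𝓝 (1 - 0)) :=
    tendsto_const_nhds.sub tendsto_one_div_atTop_nhds_zero_nat
  rw [sub_zero] at h
  refine h.congr' ?_
  filter_upwards [eventually_gt_atTop 0] with N hN0
  have hNpos : (0 : ℝ) < (N : ℝ) := by exact_mod_cast hN0
  field_simp

/-- **Composition, hypotheses form** (`<S1-sig> → <S2-sig> → <S3-sig> → <S4-sig> →` the body of
`DiluteFourierLaw`, written out so that `DiluteFourierLaw_of` below is the only theorem of this file
concluding the crux by name). Proof: `d₀ := max d₀(S4) 1`; at `d ≥ d₀`, S1 gives uniqueness, S4 gives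
`r, C, N₀`, and `k := d / r > 0`; along a steady-state family S2 gives the response limits `D_N`, each
a response coefficient at `(N, T)`; for `N ≥ max N₀ 2`, S3 gives `D_N > 0` and S4 the staircase
`|(N-1)/D_N - rN/d| ≤ C`, so `((N-1)/D_N)/N → r/d` and `D_N = ((N-1)/N)/(((N-1)/D_N)/N) → 1/(r/d) = d/r`. -/
theorem of_parts
    (hU : ∀ ω₂ lam β γ : ℝ, 0 < ω₂ → 0 < lam → 0 < β → 0 < γ → ∀ (d N : ℕ) (T_L T_R : ℝ),
      0 < T_L → 0 < T_R → ∀ μ ν : Measure (PhaseSpace N),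
        (diluteChain ω₂ lam β γ d).IsSteadyState N T_L T_R μ →
        (diluteChain ω₂ lam β γ d).IsSteadyState N T_L T_R ν → μ = ν)
    (hR : ∀ ω₂ lam β γ : ℝ, 0 < ω₂ → 0 < lam → 0 < β → 0 < γ → ∀ d : ℕ,
      (∀ (N : ℕ) (T_L T_R : ℝ), 0 < T_L → 0 < T_R → ∀ μ ν : Measure (PhaseSpace N),
        (diluteChain ω₂ lam β γ d).IsSteadyState N T_L T_R μ →
        (diluteChain ω₂ lam β γ d).IsSteadyState N T_L T_R ν → μ = ν) →
      ∀ μ : (N : ℕ) → ℝ → ℝ → Measure (PhaseSpace N),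
      (∀ (N : ℕ) (T_L T_R : ℝ), 0 < T_L → 0 < T_R →
        (diluteChain ω₂ lam β γ d).IsSteadyState N T_L T_R (μ N T_L T_R)) →
      ∀ T : ℝ, 0 < T → ∀ N : ℕ, ∃ D : ℝ,
        Tendsto (fun δ : ℝ => (diluteChain ω₂ lam β γ d).totalCurrent (μ N (T + δ / 2) (T - δ / 2)) / δ)
          (𝓝[≠] 0) (𝓝 D))
    (hP : ∀ ω₂ lam β γ : ℝ, 0 < ω₂ → 0 < lam → 0 < β → 0 < γ → ∀ T : ℝ, 0 < T → ∀ d : ℕ,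
      (∀ (N : ℕ) (T_L T_R : ℝ), 0 < T_L → 0 < T_R → ∀ μ ν : Measure (PhaseSpace N),
        (diluteChain ω₂ lam β γ d).IsSteadyState N T_L T_R μ →
        (diluteChain ω₂ lam β γ d).IsSteadyState N T_L T_R ν → μ = ν) →
      ∀ N : ℕ, 2 ≤ N → ∀ D : ℝ, (diluteChain ω₂ lam β γ d).IsResponseCoeff N T D → 0 < D)
    (hO : ∀ ω₂ lam β γ : ℝ, 0 < ω₂ → 0 < lam → 0 < β → 0 < γ → ∀ T : ℝ, 0 < T →
      ∃ d₀ : ℕ, ∀ d : ℕ, d₀ ≤ d →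
      (∀ (N : ℕ) (T_L T_R : ℝ), 0 < T_L → 0 < T_R → ∀ μ ν : Measure (PhaseSpace N),
        (diluteChain ω₂ lam β γ d).IsSteadyState N T_L T_R μ →
        (diluteChain ω₂ lam β γ d).IsSteadyState N T_L T_R ν → μ = ν) →
      ∃ r : ℝ, 0 < r ∧ ∃ (C : ℝ) (N₀ : ℕ), ∀ N : ℕ, N₀ ≤ N → ∀ D : ℝ,
        (diluteChain ω₂ lam β γ d).IsResponseCoeff N T D → 0 < D →
        |((N : ℝ) - 1) / D - r * (N : ℝ) / (d : ℝ)| ≤ C) :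
    ∀ ω₂ lam β γ : ℝ, 0 < ω₂ → 0 < lam → 0 < β → 0 < γ → ∀ T : ℝ, 0 < T →
      ∃ d₀ : ℕ, ∀ d : ℕ, d₀ ≤ d → (diluteChain ω₂ lam β γ d).FouriersLawAt T := by
  intro ω₂ lam β γ hω hl hβ hγ T hT
  obtain ⟨d₀, hd₀⟩ := hO ω₂ lam β γ hω hl hβ hγ T hT
  refine ⟨max d₀ 1, fun d hd => ?_⟩
  have hdd₀ : d₀ ≤ d := le_trans (le_max_left _ _) hd
  have hd1 : 1 ≤ d := le_trans (le_max_right _ _) hd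
  have hdpos : (0 : ℝ) < (d : ℝ) := by exact_mod_cast hd1
  -- S1: uniqueness of the weak steady states of `C_d`
  have huniq := hU ω₂ lam β γ hω hl hβ hγ d
  -- S4: per-cell resistance and the staircase bound
  obtain ⟨r, hr, C, N₀, hstair⟩ := hd₀ d hdd₀ huniq
  refine ⟨(d : ℝ) / r, div_pos hdpos hr, fun μ hμ => ?_⟩
  -- S2: the response limits exist along the family
  choose D hD using hR ω₂ lam β γ hω hl hβ hγ d huniq μ hμ T hT
  refine ⟨D, hD, ?_⟩
  -- each `D N` is a response coefficient of `C_d` at `(N, T)`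
  have hcoef : ∀ N : ℕ, (diluteChain ω₂ lam β γ d).IsResponseCoeff N T (D N) := fun N =>
    ⟨μ N, fun T_L T_R hL hR' => hμ N T_L T_R hL hR', hD N⟩
  -- S3 + S4 on the tail `N ≥ max N₀ 2`
  have htail : ∀ N : ℕ, max N₀ 2 ≤ N →
      0 < D N ∧ |((N : ℝ) - 1) / D N - r * (N : ℝ) / (d : ℝ)| ≤ C := by
    intro N hN
    have hN₀ : N₀ ≤ N := le_trans (le_max_left _ _) hN
    have hN2 : 2 ≤ N := le_trans (le_max_right _ _) hN
    have hDpos : 0 < D N := hP ω₂ lam β γ hω hl hβ hγ T hT d huniq N hN2 (D N) (hcoef N)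
    exact ⟨hDpos, hstair N hN₀ (D N) (hcoef N) hDpos⟩
  -- the resistance per site converges: `((N-1)/D N)/N → r/d`
  have hres : Tendsto (fun N : ℕ => ((N : ℝ) - 1) / D N / (N : ℝ)) atTop (𝓝 (r / (d : ℝ))) :=
    tendsto_div_nat_of_abs_sub_linear_le (N₀ := max N₀ 2) fun N hN => (htail N hN).2
  have hrd : r / (d : ℝ) ≠ 0 := (div_pos hr hdpos).ne'
  -- `D N = ((N-1)/N) / (((N-1)/D N)/N)` on the tail
  have hlim : Tendsto (fun N : ℕ => ((N : ℝ) - 1) / (N : ℝ) / (((N : ℝ) - 1) / D N / (N : ℝ)))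
      atTop (𝓝 (1 / (r / (d : ℝ)))) := tendsto_sub_one_div_nat.div hres hrd
  rw [one_div_div] at hlim
  refine hlim.congr' ?_
  filter_upwards [eventually_ge_atTop (max N₀ 2)] with N hN
  have hDpos : 0 < D N := (htail N hN).1
  have hN2 : (2 : ℝ) ≤ (N : ℝ) := by exact_mod_cast le_trans (le_max_right _ _) hN
  have hN1 : (0 : ℝ) < (N : ℝ) - 1 := by linarith
  have hNpos : (0 : ℝ) < (N : ℝ) := by linarith
  field_simp

/-- **The skeleton theorem.** The four stubs imply the crux `DiluteCellGaussianiser.DiluteFourierLaw`,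
concluded BY NAME; the only unproved inputs are `stub_diluteNessUnique`,
`stub_diluteFiniteResponseOfUnique`, `stub_positiveResponse`, `stub_ohmicStaircase`. -/
theorem DiluteFourierLaw_of : DiluteFourierLaw :=
  of_parts stub_diluteNessUnique stub_diluteFiniteResponseOfUnique stub_positiveResponse
    stub_ohmicStaircase

end Summit.AtomisticToContinuum.FouriersLaw.Cruxes.DiluteFourierLaw.Birth

end
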